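import Mathlib
import Literature.Analysis.FluidPDE.SpaceTimeCalculusC1
import Literature.Analysis.FluidPDE.LeraySeparationOfEnergyTools
import Summits.NavierStokesRegularity.NavierStokesRegularity.Theorems.LandauTailLandauTailBlowupShellEnergyFloor
import Summits.NavierStokesRegularity.NavierStokesRegularity.Theorems.LandauTailLandauTailBlowupVorticityMoment

/-!
# Crux `LandauTail.LandauTailBlowup` (stmt-NavierStokesRegularity-1944), line `registered`, cycle c7:
  tools for the shell theorems — the integrated shell error, the vorticity moment on a ball, the quarter window

Helper file on the proof path of the crux item `stmt-NavierStokesRegularity-1944`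
(`Summit.NavierStokesRegularity.NavierStokesRegularity.Theses.LandauTail.LandauTailBlowup`), lead c7, serving the
registered support stubs `landauTail_shell_enstrophy_floor` (L3) and `landauTail_momentum_loss_tame` (L7):

* `landauTail_shell_error_integral` — the INTEGRATED SHELL ERROR: from the per-time bound
  `|F(t) + β| ≤ A₁ ∫_S |v(t) − U| + A₂ ∫_S |v(t) − U|²` of the momentum law and the space-time shell defect
  `∫∫_{(s₁,s₂)×S}|v − U|² ≤ d`, Young's inequality with parameter `γ` gives
  `∫_{s₁}^{s₂}|F + β| ≤ A₁ (d/(2γ) + (γ/2)ρ³|B₁|(s₂−s₁)) + A₂ d` (Tonelli on the shell, all in `ℝ≥0∞`);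
* `landauTail_shellEnstrophy_moment_le` — the momentum against `curl Ψ` is a vorticity moment:
  `|∫⟪v, curl Ψ⟫| ≤ (2Kρ/θ)∫_{B_ρ}|∇v|²_F + 2Kθρ⁴|B₁|`;
* `landauTail_shellEnstrophy_line`, `landauTail_shellEnstrophy_quarter` — the momentum stays within `∫|F + β|` of
  the line `M(s₁) − β(t − s₁)`, which is large on a quarter of the window.

References: L. D. Landau 1944; G. K. Batchelor 1967 §4.6; A. J. Majda, A. L. Bertozzi 2002 §1.2 (vorticity identities).
-/

set_option linter.dupNamespace false

noncomputable section

open Filter Set Topology MeasureTheory Metric Function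
open scoped ENNReal NNReal InnerProductSpace RealInnerProductSpace Laplacian ContDiff
open Literature.Analysis.FluidPDE

namespace Summit.NavierStokesRegularity.NavierStokesRegularity.Theorems

/-- The Frobenius norm-square is a continuous function of the linear map. [folklore] -/
theorem landauTail_shellEnstrophy_continuous_frobeniusNormSq :
    Continuous fun L : EuclideanSpace ℝ (Fin 3) →L[ℝ] EuclideanSpace ℝ (Fin 3) => frobeniusNormSq L := by
  unfold frobeniusNormSq
  refine continuous_finsetSum _ fun i _ => ?_
  exact ((ContinuousLinearMap.apply ℝ (EuclideanSpace ℝ (Fin 3))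
    (stdOrthonormalBasis ℝ (EuclideanSpace ℝ (Fin 3)) i)).continuous.norm).pow 2

/-- **The vorticity-moment bound on a ball, energy form**: for `v ∈ C¹`, a `C²` potential `Ψ` supported in
`B_ρ` with `|Ψ| ≤ Kρ`, and `θ > 0`,
`|∫⟪v, curl Ψ⟫| ≤ (2Kρ/θ) ∫_{B_ρ} |∇v|²_F + 2Kθρ⁴|B₁|` (`|curl| ≤ 4|∇|`, Young, `‖·‖²_op ≤ |·|²_F`). [folklore] -/
theorem landauTail_shellEnstrophy_moment_le {v Ψ : EuclideanSpace ℝ (Fin 3) → EuclideanSpace ℝ (Fin 3)}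
    {K ρ θ : ℝ} (hv : ContDiff ℝ 1 v) (hΨ : ContDiff ℝ 2 Ψ) (hΨc : HasCompactSupport Ψ)
    (hΨsupp : tsupport Ψ ⊆ ball (0 : EuclideanSpace ℝ (Fin 3)) ρ) (hΨK : ∀ x, ‖Ψ x‖ ≤ K * ρ) (hK : 0 ≤ K)
    (hρ : 0 < ρ) (hθ : 0 < θ) :
    |∫ x, ⟪v x, curl Ψ x⟫| ≤ 2 * K * ρ / θ *
        (∫ x in ball (0 : EuclideanSpace ℝ (Fin 3)) ρ, frobeniusNormSq (fderiv ℝ v x)) +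
      2 * K * θ * ρ ^ 4 * (volume (ball (0 : EuclideanSpace ℝ (Fin 3)) 1)).toReal := by
  set V₁ : ℝ := (volume (ball (0 : EuclideanSpace ℝ (Fin 3)) 1)).toReal with hV₁_def
  have hDc : Continuous fun x => fderiv ℝ v x := hv.continuous_fderiv one_ne_zero
  have hFc : Continuous fun x => frobeniusNormSq (fderiv ℝ v x) :=
    landauTail_shellEnstrophy_continuous_frobeniusNormSq.comp hDc
  have hFint : IntegrableOn (fun x => frobeniusNormSq (fderiv ℝ v x)) (ball (0 : EuclideanSpace ℝ (Fin 3)) ρ)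
      volume :=
    (hFc.continuousOn.integrableOn_compact (isCompact_closedBall 0 ρ)).mono_set ball_subset_closedBall
  have hW4 := landauTail_vorticity_moment_bound Ψ v hΨ hΨc hv
  -- `∫ |Ψ| |∇v| = ∫_{B_ρ} |Ψ| |∇v| ≤ ∫_{B_ρ} (Kρ/(2θ') |∇v|² + θ' Kρ/2)` with `θ' = θ`
  have hball : ∫ x, ‖Ψ x‖ * ‖fderiv ℝ v x‖ =
      ∫ x in ball (0 : EuclideanSpace ℝ (Fin 3)) ρ, ‖Ψ x‖ * ‖fderiv ℝ v x‖ := by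
    refine (setIntegral_eq_integral_of_forall_compl_eq_zero fun x hx => ?_).symm
    have hx' : x ∉ tsupport Ψ := fun h => hx (hΨsupp h)
    rw [image_eq_zero_of_notMem_tsupport hx', norm_zero, zero_mul]
  have hvolB : (volume (ball (0 : EuclideanSpace ℝ (Fin 3)) ρ)).toReal = ρ ^ 3 * V₁ := by
    rw [landauTail_shellFloor_volume_ball hρ, ENNReal.toReal_mul, ENNReal.toReal_ofReal (by positivity),
      hV₁_def]
  have hpt : ∀ x, ‖Ψ x‖ * ‖fderiv ℝ v x‖ ≤
      K * ρ / (2 * θ) * frobeniusNormSq (fderiv ℝ v x) + K * ρ * θ / 2 := by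
    intro x
    have h1 : ‖Ψ x‖ * ‖fderiv ℝ v x‖ ≤ K * ρ * ‖fderiv ℝ v x‖ :=
      mul_le_mul_of_nonneg_right (hΨK x) (norm_nonneg _)
    have h2 : ‖fderiv ℝ v x‖ ≤ ‖fderiv ℝ v x‖ ^ 2 / (2 * θ) + θ / 2 :=
      landauTail_shellFloor_norm_le (fderiv ℝ v x) hθ
    have h3 : ‖fderiv ℝ v x‖ ^ 2 ≤ frobeniusNormSq (fderiv ℝ v x) := norm_sq_le_frobeniusNormSq _
    have h4 : ‖fderiv ℝ v x‖ ^ 2 / (2 * θ) ≤ frobeniusNormSq (fderiv ℝ v x) / (2 * θ) :=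
      div_le_div_of_nonneg_right h3 (by positivity)
    have hKρ : 0 ≤ K * ρ := by positivity
    calc ‖Ψ x‖ * ‖fderiv ℝ v x‖ ≤ K * ρ * ‖fderiv ℝ v x‖ := h1
      _ ≤ K * ρ * (frobeniusNormSq (fderiv ℝ v x) / (2 * θ) + θ / 2) :=
          mul_le_mul_of_nonneg_left (h2.trans (by linarith)) hKρ
      _ = K * ρ / (2 * θ) * frobeniusNormSq (fderiv ℝ v x) + K * ρ * θ / 2 := by ring
  have hle : ∫ x, ‖Ψ x‖ * ‖fderiv ℝ v x‖ ≤
      K * ρ / (2 * θ) * (∫ x in ball (0 : EuclideanSpace ℝ (Fin 3)) ρ, frobeniusNormSq (fderiv ℝ v x)) +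
        K * ρ * θ / 2 * (ρ ^ 3 * V₁) := by
    rw [hball]
    calc ∫ x in ball (0 : EuclideanSpace ℝ (Fin 3)) ρ, ‖Ψ x‖ * ‖fderiv ℝ v x‖
        ≤ ∫ x in ball (0 : EuclideanSpace ℝ (Fin 3)) ρ,
            (K * ρ / (2 * θ) * frobeniusNormSq (fderiv ℝ v x) + K * ρ * θ / 2) := by
          refine integral_mono_of_nonneg (Eventually.of_forall fun x => by positivity) ?_
            (Eventually.of_forall hpt)
          exact (hFint.const_mul _).add (integrableOn_const measure_ball_lt_top.ne)
      _ = K * ρ / (2 * θ) * (∫ x in ball (0 : EuclideanSpace ℝ (Fin 3)) ρ, frobeniusNormSq (fderiv ℝ v x)) +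
            K * ρ * θ / 2 * (ρ ^ 3 * V₁) := by
          rw [integral_add (hFint.const_mul _) (integrableOn_const measure_ball_lt_top.ne), integral_const_mul,
            setIntegral_const, smul_eq_mul, measureReal_def, hvolB]
          ring
  calc |∫ x, ⟪v x, curl Ψ x⟫| ≤ 4 * ∫ x, ‖Ψ x‖ * ‖fderiv ℝ v x‖ := hW4
    _ ≤ 4 * (K * ρ / (2 * θ) * (∫ x in ball (0 : EuclideanSpace ℝ (Fin 3)) ρ, frobeniusNormSq (fderiv ℝ v x)) +
          K * ρ * θ / 2 * (ρ ^ 3 * V₁)) := by linarith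
    _ = 2 * K * ρ / θ * (∫ x in ball (0 : EuclideanSpace ℝ (Fin 3)) ρ, frobeniusNormSq (fderiv ℝ v x)) +
          2 * K * θ * ρ ^ 4 * V₁ := by ring

/-- If `M′ = F` on `[s₁, s₂]` with `F` continuous and `∫_{s₁}^{s₂} |F + β| ≤ B`, then for every `t ∈ [s₁, s₂]`
the momentum stays within `B` of the line: `|M(t) − (M(s₁) − β (t − s₁))| ≤ B`. [folklore] -/
theorem landauTail_shellEnstrophy_line {M F : ℝ → ℝ} {β B s₁ s₂ : ℝ} (hs : s₁ < s₂)
    (hder : ∀ t ∈ Icc s₁ s₂, HasDerivAt M (F t) t) (hcont : ContinuousOn F (Icc s₁ s₂))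
    (hint : ∫ t in Ioo s₁ s₂, |F t + β| ≤ B) {t : ℝ} (ht : t ∈ Icc s₁ s₂) :
    |M t - (M s₁ - β * (t - s₁))| ≤ B := by
  have hsub : uIcc s₁ t ⊆ Icc s₁ s₂ := by rw [uIcc_of_le ht.1]; exact Icc_subset_Icc_right ht.2
  have hFint : IntervalIntegrable F volume s₁ t := (hcont.mono hsub).intervalIntegrable
  have hFint2 : IntervalIntegrable (fun u => |F u + β|) volume s₁ s₂ :=
    ((hcont.add continuousOn_const).abs.mono (by rw [uIcc_of_le hs.le])).intervalIntegrable
  have hFTC : ∫ u in s₁..t, F u = M t - M s₁ :=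
    intervalIntegral.integral_eq_sub_of_hasDerivAt (fun u hu => hder u (hsub hu)) hFint
  have h1 : ∫ u in s₁..t, (F u + β) = (M t - M s₁) + β * (t - s₁) := by
    rw [intervalIntegral.integral_add hFint (by simp), hFTC, intervalIntegral.integral_const, smul_eq_mul]
    ring
  have h2 : |∫ u in s₁..t, (F u + β)| ≤ ∫ u in s₁..t, |F u + β| :=
    intervalIntegral.abs_integral_le_integral_abs ht.1
  have h3 : ∫ u in s₁..t, |F u + β| ≤ ∫ u in s₁..s₂, |F u + β| :=
    intervalIntegral.integral_mono_interval le_rfl ht.1 ht.2 (Eventually.of_forall fun u => abs_nonneg _) hFint2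
  have h4 : ∫ u in s₁..s₂, |F u + β| = ∫ u in Ioo s₁ s₂, |F u + β| := by
    rw [intervalIntegral.integral_of_le hs.le, integral_Ioc_eq_integral_Ioo]
  have h5 : |(M t - M s₁) + β * (t - s₁)| ≤ B := by rw [← h1]; linarith
  rw [show M t - (M s₁ - β * (t - s₁)) = (M t - M s₁) + β * (t - s₁) by ring]
  exact h5

/-- The quarter-window on which the momentum is large: if `|M(t) − (M(s₁) − β(t−s₁))| ≤ β(s₂−s₁)/8` on `[s₁,s₂]`
then there is an open interval `J ⊆ (s₁, s₂)` of length `(s₂−s₁)/4` with `|M| ≥ β(s₂−s₁)/8` on `J`. [folklore] -/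
theorem landauTail_shellEnstrophy_quarter {M : ℝ → ℝ} {β s₁ s₂ : ℝ} (hs : s₁ < s₂) (hβ : 0 < β)
    (hline : ∀ t ∈ Icc s₁ s₂, |M t - (M s₁ - β * (t - s₁))| ≤ β * (s₂ - s₁) / 8) :
    ∃ J : Set ℝ, MeasurableSet J ∧ J ⊆ Ioo s₁ s₂ ∧ volume J = ENNReal.ofReal ((s₂ - s₁) / 4) ∧
      ∀ t ∈ J, β * (s₂ - s₁) / 8 ≤ |M t| := by
  have hΔ : 0 < s₂ - s₁ := sub_pos.2 hs
  by_cases h : β * (s₂ - s₁) / 2 ≤ M s₁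
  · refine ⟨Ioo s₁ (s₁ + (s₂ - s₁) / 4), measurableSet_Ioo, Ioo_subset_Ioo_right (by linarith), ?_, ?_⟩
    · rw [Real.volume_Ioo]; congr 1; ring
    · intro t ht
      have hts : t ∈ Icc s₁ s₂ := ⟨ht.1.le, by linarith [ht.2]⟩
      have hl : β * (s₂ - s₁) / 4 ≤ M s₁ - β * (t - s₁) := by nlinarith [ht.2, ht.1]
      have := hline t hts
      have h1 := neg_abs_le (M t - (M s₁ - β * (t - s₁)))
      have : β * (s₂ - s₁) / 8 ≤ M t := by linarith
      exact this.trans (le_abs_self _)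
  · rw [not_le] at h
    refine ⟨Ioo (s₂ - (s₂ - s₁) / 4) s₂, measurableSet_Ioo, Ioo_subset_Ioo_left (by linarith), ?_, ?_⟩
    · rw [Real.volume_Ioo]; congr 1; ring
    · intro t ht
      have hts : t ∈ Icc s₁ s₂ := ⟨by linarith [ht.1], ht.2.le⟩
      have hl : M s₁ - β * (t - s₁) ≤ -(β * (s₂ - s₁) / 4) := by nlinarith [ht.1, ht.2]
      have := hline t hts
      have h1 := le_abs_self (M t - (M s₁ - β * (t - s₁)))
      have : β * (s₂ - s₁) / 8 ≤ -M t := by linarith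
      exact this.trans (neg_le_abs _)

/-- **The integrated shell error.** For a classical flow `v` on `(−1,0)`, a field `U` continuous off the origin, a
flux `F` continuous on `(−1,0)` obeying the shell error bound
`|F(t) + β| ≤ A₁ ∫_S |v(t) − U| + A₂ ∫_S |v(t) − U|²` on the shell `S = B_ρ ∖ B̄_{ρ/2}`, and a window
`−1 < s₁ < s₂ < 0` on which the space-time shell defect is `∫∫_{(s₁,s₂)×S}|v − U|² ≤ d`, Young's inequality with
parameter `γ > 0` gives
`∫_{s₁}^{s₂} |F + β| ≤ A₁ (d/(2γ) + (γ/2) ρ³|B₁| (s₂ − s₁)) + A₂ d`. [folklore] -/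
theorem landauTail_shell_error_integral
    {U : EuclideanSpace ℝ (Fin 3) → EuclideanSpace ℝ (Fin 3)}
    {v : ℝ → EuclideanSpace ℝ (Fin 3) → EuclideanSpace ℝ (Fin 3)} {q : ℝ → EuclideanSpace ℝ (Fin 3) → ℝ}
    {F : ℝ → ℝ} {β A₁ A₂ ρ s₁ s₂ γ d : ℝ} (hUc : ContinuousOn U {0}ᶜ)
    (hcl : IsClassicalNSSolutionOn (Ioo (-1 : ℝ) 0) 1 0 v q) (hρ : 0 < ρ) (hA₁ : 0 ≤ A₁) (hA₂ : 0 ≤ A₂)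
    (hcont : ContinuousOn F (Ioo (-1 : ℝ) 0))
    (herr : ∀ t ∈ Ioo (-1 : ℝ) 0, |F t + β| ≤
      A₁ * (∫ x in ball (0 : EuclideanSpace ℝ (Fin 3)) ρ \ closedBall (0 : EuclideanSpace ℝ (Fin 3)) (ρ / 2),
        ‖v t x - U x‖) +
      A₂ * (∫ x in ball (0 : EuclideanSpace ℝ (Fin 3)) ρ \ closedBall (0 : EuclideanSpace ℝ (Fin 3)) (ρ / 2),
        ‖v t x - U x‖ ^ 2))
    (hs₁ : -1 < s₁) (hs₁₂ : s₁ < s₂) (hs₂ : s₂ < 0) (hγ : 0 < γ) (hd0 : 0 ≤ d)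
    (hd : ∫⁻ z in Ioo s₁ s₂ ×ˢ (ball (0 : EuclideanSpace ℝ (Fin 3)) ρ \
        closedBall (0 : EuclideanSpace ℝ (Fin 3)) (ρ / 2)), ‖v z.1 z.2 - U z.2‖ₑ ^ 2 ≤ ENNReal.ofReal d) :
    ∫ t in Ioo s₁ s₂, |F t + β| ≤
      A₁ * (1 / (2 * γ) * d + γ / 2 * (ρ ^ 3 * (volume (ball (0 : EuclideanSpace ℝ (Fin 3)) 1)).toReal) *
        (s₂ - s₁)) + A₂ * d := by
  set V₁ : ℝ := (volume (ball (0 : EuclideanSpace ℝ (Fin 3)) 1)).toReal with hV₁_def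
  have hV₁top : volume (ball (0 : EuclideanSpace ℝ (Fin 3)) 1) ≠ ⊤ := measure_ball_lt_top.ne
  set Δs : ℝ := s₂ - s₁ with hΔs_def
  have hΔs : 0 < Δs := by rw [hΔs_def]; linarith
  set S : Set (EuclideanSpace ℝ (Fin 3)) := ball (0 : EuclideanSpace ℝ (Fin 3)) ρ \
    closedBall (0 : EuclideanSpace ℝ (Fin 3)) (ρ / 2) with hS_def
  set T : Set (EuclideanSpace ℝ (Fin 3)) := closedBall (0 : EuclideanSpace ℝ (Fin 3)) ρ \
    ball (0 : EuclideanSpace ℝ (Fin 3)) (ρ / 2) with hT_def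
  set I : Set ℝ := Ioo s₁ s₂ with hI_def
  have hST : S ⊆ T := sdiff_subset_sdiff ball_subset_closedBall ball_subset_closedBall
  have hTc : IsCompact T := (isCompact_closedBall _ _).diff isOpen_ball
  have hSm : MeasurableSet S := measurableSet_ball.diff measurableSet_closedBall
  have hT0 : T ⊆ {0}ᶜ := by
    intro x hx h0
    rw [mem_singleton_iff] at h0
    exact hx.2 (by rw [h0]; exact mem_ball_self (by positivity))
  have hIsub : I ⊆ Ioo (-1 : ℝ) 0 := fun t ht => ⟨hs₁.trans ht.1, ht.2.trans hs₂⟩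
  have hIcc : Icc s₁ s₂ ⊆ Ioo (-1 : ℝ) 0 := fun t ht => ⟨hs₁.trans_le ht.1, ht.2.trans_lt hs₂⟩
  have hvc : ContinuousOn (uncurry v) (Ioo (-1 : ℝ) 0 ×ˢ univ) := hcl.smooth_velocity.continuousOn
  have hwc : ContinuousOn (fun z : ℝ × EuclideanSpace ℝ (Fin 3) => v z.1 z.2 - U z.2)
      (Ioo (-1 : ℝ) 0 ×ˢ T) :=
    (hvc.mono (prod_mono Subset.rfl (subset_univ _))).sub
      (hUc.comp continuous_snd.continuousOn fun z hz => hT0 hz.2)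
  have hslice : ∀ t ∈ Ioo (-1 : ℝ) 0, ContinuousOn (fun x => v t x - U x) T := fun t ht =>
    (hcl.contDiff_velocity ht).continuous.continuousOn.sub (hUc.mono hT0)
  set G1 : ℝ → ℝ≥0∞ := fun t => ∫⁻ x in S, ‖v t x - U x‖ₑ with hG1_def
  set G2 : ℝ → ℝ≥0∞ := fun t => ∫⁻ x in S, ‖v t x - U x‖ₑ ^ 2 with hG2_def
  have hg1 : ∀ t ∈ Ioo (-1 : ℝ) 0, ENNReal.ofReal (∫ x in S, ‖v t x - U x‖) ≤ G1 t := by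
    intro t ht
    rw [landauTail_shellFloor_integral_eq_toReal (g := fun x => ‖v t x - U x‖) hTc hST hSm (hslice t ht).norm
      (fun x _ => norm_nonneg _)]
    exact ENNReal.ofReal_toReal_le.trans (le_of_eq (lintegral_congr fun x => ofReal_norm _))
  have hg2 : ∀ t ∈ Ioo (-1 : ℝ) 0, ENNReal.ofReal (∫ x in S, ‖v t x - U x‖ ^ 2) ≤ G2 t := by
    intro t ht
    rw [landauTail_shellFloor_integral_eq_toReal (g := fun x => ‖v t x - U x‖ ^ 2) hTc hST hSm
      ((hslice t ht).norm.pow 2) (fun x _ => by positivity)]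
    refine ENNReal.ofReal_toReal_le.trans (le_of_eq (lintegral_congr fun x => ?_))
    rw [← ofReal_norm, ENNReal.ofReal_pow (norm_nonneg _)]
  have hP : ∀ t ∈ I, ENNReal.ofReal |F t + β| ≤ ENNReal.ofReal A₁ * G1 t + ENNReal.ofReal A₂ * G2 t := by
    intro t ht
    have ht' := hIsub ht
    exact landauTail_shellFloor_ofReal_le hA₁ hA₂ (integral_nonneg fun x => norm_nonneg _)
      (integral_nonneg fun x => by positivity) (herr t ht') (hg1 t ht') (hg2 t ht')
  have hQsub : I ×ˢ S ⊆ Ioo (-1 : ℝ) 0 ×ˢ T := prod_mono hIsub hST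
  have hQm : MeasurableSet (I ×ˢ S) := measurableSet_Ioo.prod hSm
  have hwm : AEMeasurable (fun z : ℝ × EuclideanSpace ℝ (Fin 3) => v z.1 z.2 - U z.2)
      ((volume.restrict I).prod (volume.restrict S)) := by
    rw [Measure.prod_restrict, ← Measure.volume_eq_prod]
    exact ((hwc.mono hQsub).aestronglyMeasurable hQm).aemeasurable
  have hG1m : AEMeasurable G1 (volume.restrict I) := hwm.enorm.lintegral_prod_right'
  have hG2m : AEMeasurable G2 (volume.restrict I) := (hwm.enorm.pow_const 2).lintegral_prod_right'
  have hT2 : ∫⁻ t in I, G2 t ≤ ENNReal.ofReal d := by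
    have h := setLIntegral_prod (μ := (volume : Measure ℝ)) (ν := (volume : Measure (EuclideanSpace ℝ (Fin 3))))
      (s := I) (t := S) (fun z : ℝ × EuclideanSpace ℝ (Fin 3) => ‖v z.1 z.2 - U z.2‖ₑ ^ 2)
      (by rw [← Measure.prod_restrict]; exact hwm.enorm.pow_const 2)
    rw [← Measure.volume_eq_prod] at h
    rw [← h]
    exact hd
  have hV : volume (ball (0 : EuclideanSpace ℝ (Fin 3)) 1) = ENNReal.ofReal V₁ := by
    rw [hV₁_def, ENNReal.ofReal_toReal hV₁top]
  have hvolS : volume S ≤ ENNReal.ofReal (ρ ^ 3 * V₁) := by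
    calc volume S ≤ volume (ball (0 : EuclideanSpace ℝ (Fin 3)) ρ) := measure_mono fun x hx => hx.1
      _ = ENNReal.ofReal (ρ ^ 3 * V₁) := by
          rw [landauTail_shellFloor_volume_ball hρ, hV, ← ENNReal.ofReal_mul (by positivity)]
  have hvolI : volume I = ENNReal.ofReal Δs := by rw [hI_def, Real.volume_Ioo]
  have hT1 : ∫⁻ t in I, G1 t ≤ ENNReal.ofReal (1 / (2 * γ)) * ENNReal.ofReal d +
      ENNReal.ofReal (γ / 2) * ENNReal.ofReal (ρ ^ 3 * V₁) * ENNReal.ofReal Δs := by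
    have hpt : ∀ t, G1 t ≤ ENNReal.ofReal (1 / (2 * γ)) * G2 t + ENNReal.ofReal (γ / 2) * volume S := by
      intro t
      calc G1 t ≤ ∫⁻ x in S, (ENNReal.ofReal (1 / (2 * γ)) * ‖v t x - U x‖ₑ ^ 2 + ENNReal.ofReal (γ / 2)) :=
            lintegral_mono fun x => landauTail_shellFloor_enorm_le _ hγ
        _ = ENNReal.ofReal (1 / (2 * γ)) * G2 t + ENNReal.ofReal (γ / 2) * volume S := by
            rw [lintegral_add_right _ measurable_const, lintegral_const_mul' _ _ ENNReal.ofReal_ne_top,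
              setLIntegral_const]
    calc ∫⁻ t in I, G1 t
        ≤ ∫⁻ t in I, (ENNReal.ofReal (1 / (2 * γ)) * G2 t + ENNReal.ofReal (γ / 2) * volume S) :=
          lintegral_mono fun t => hpt t
      _ = ENNReal.ofReal (1 / (2 * γ)) * (∫⁻ t in I, G2 t) + ENNReal.ofReal (γ / 2) * volume S * volume I := by
          rw [lintegral_add_right' _ aemeasurable_const, lintegral_const_mul'' _ hG2m, setLIntegral_const]
      _ ≤ _ := by
          rw [hvolI]
          gcongr
  have hB : ∫⁻ t in I, ENNReal.ofReal |F t + β| ≤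
      ENNReal.ofReal (A₁ * (1 / (2 * γ) * d + γ / 2 * (ρ ^ 3 * V₁) * Δs) + A₂ * d) := by
    calc ∫⁻ t in I, ENNReal.ofReal |F t + β|
        ≤ ∫⁻ t in I, (ENNReal.ofReal A₁ * G1 t + ENNReal.ofReal A₂ * G2 t) := setLIntegral_mono' measurableSet_Ioo hP
      _ = ENNReal.ofReal A₁ * (∫⁻ t in I, G1 t) + ENNReal.ofReal A₂ * (∫⁻ t in I, G2 t) := by
          rw [lintegral_add_left' (hG1m.const_mul _), lintegral_const_mul'' _ hG1m, lintegral_const_mul'' _ hG2m]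
      _ ≤ ENNReal.ofReal A₁ * (ENNReal.ofReal (1 / (2 * γ)) * ENNReal.ofReal d +
            ENNReal.ofReal (γ / 2) * ENNReal.ofReal (ρ ^ 3 * V₁) * ENNReal.ofReal Δs) +
            ENNReal.ofReal A₂ * ENNReal.ofReal d := by
          gcongr
      _ = ENNReal.ofReal (A₁ * (1 / (2 * γ) * d + γ / 2 * (ρ ^ 3 * V₁) * Δs) + A₂ * d) := by
          rw [← ENNReal.ofReal_mul (by positivity), ← ENNReal.ofReal_mul (by positivity),
            ← ENNReal.ofReal_mul (by positivity), ← ENNReal.ofReal_add (by positivity) (by positivity),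
            ← ENNReal.ofReal_mul hA₁, ← ENNReal.ofReal_mul hA₂, ← ENNReal.ofReal_add (by positivity) (by positivity)]
  have hFlc : ContinuousOn (fun t => F t + β) (Icc s₁ s₂) := (hcont.mono hIcc).add continuousOn_const
  have hm : AEStronglyMeasurable (fun t => |F t + β|) (volume.restrict I) :=
    ((hFlc.mono Ioo_subset_Icc_self).abs).aestronglyMeasurable measurableSet_Ioo
  rw [integral_eq_lintegral_of_nonneg_ae (Eventually.of_forall fun t => abs_nonneg _) hm]
  exact ENNReal.toReal_le_of_le_ofReal (by positivity) hB

end Summit.NavierStokesRegularity.NavierStokesRegularity.Theorems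

end
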